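import Literature.Probability.RandomPlanarGeometry.SAWStripTMAt
import HarnessLib

/-!
# Evaluations of the strip transfer matrix at fugacity `250/651 = 1/2.604` (span 6, 81 rows) (`native_decide`)

Topic `Literature/Probability/RandomPlanarGeometry`. Compiled evaluations of the fixed-point weighted counts
`StripTM.dpAt 250 651 l r₀ (2^64) H` (`SAWStripTMAt.lean`: irreducible bridges of span `l` in the `l × H` grid
with start row `r₀`, weight `⌊2⁶⁴ (250/651)^{|s|}⌋` summed with rounding down), the span-`l` contributions to
Kesten's irreducible-bridge Kraft sum at fugacity `1/2.604` (Jensen 2004, §2, eq. (4)) used by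
`SAWLowerBound2604.lean`. The only non-standard axiom is `Lean.ofReduceBool` (`native_decide`, declared
`computational`).

## References

* I. Jensen, *Improved lower bounds on the connective constants for two-dimensional self-avoiding
  walks*, J. Phys. A 37 (2004) 11521–11529, §2 [Jensen2004SAWLowerBounds].
-/

namespace Literature.Probability.RandomPlanarGeometry.SAW.StripTM

/-- Span 6 at fugacity `250/651` (`/ 2⁶⁴ = 0.0114880`). [cite: Jensen2004SAWLowerBounds, §2] -/
theorem dpAt_six_2604 : dpAt 250 651 6 40 (2 ^ 64) 81 = 211917112162111420 := by native_decide

end Literature.Probability.RandomPlanarGeometry.SAW.StripTM
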